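import Literature.NumberTheory.Automorphic.UnitaryGroupTorusSiegelIntegral
import Literature.NumberTheory.Automorphic.UnitaryGroupHeisenberg
import Literature.NumberTheory.Automorphic.IdeleNormOneSplitting
import Literature.NumberTheory.Automorphic.DoubledUnitaryRankOneReductionRay
import HarnessLib

/-!
# The diagonal ray and the coordinate compacta of the adelic torus of `U(3)`; the ray integral of the
# cusp estimate in torus coordinates

Topic `NumberTheory/Automorphic`; namespace `Literature.NumberTheory.Automorphic.UnitaryGroup`. THEOREMS ONLY (no definition,
no named fact, no instance, no notation, no `sorry`).  Sequel of ★ `UnitaryGroupTorusSiegelIntegral` (row H10b «RAY INTEGRAL» of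
the T1-qs skeleton cut of the law `TruncatedKernelIntegrable`, cell `pub/hodgecm-mathlib`, crux H413 = `stmt-HodgeConjecture-24833`):
the BRIDGE from the COORDINATE description of the torus Siegel set exported by row H9a (`UnitaryGroupTorusSiegelSet`:
«`d₀(t) = w · z_E(e^s)`, `w ∈ C`; `d₁(t) ∈ C₁`», `C, C₁ ⊆ 𝕀_E` compact) to the «compact · ray» hypothesis
`S ⊆ Set.range ρ * 𝔎` of ★ `setLIntegral_rpow_neg_borelHeight_lt_top`.  HC_CM is proved only modulo the printed citations until
rung 0 closes.

For Rogawski's quasi-split `U(3) = U(J₃)` over `E ∕ F` with involution `c` (`c * c = 1`) the adelic torus is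
`T(𝔸_F) = {d(a, b, (c a)⁻¹) : a ∈ 𝕀_E, c(b) b = 1}` (★ `glDiagonal_mem_unitaryGroupOfForm_antidiagonal_iff`, ★ `torus_relations`),
with coordinates `dᵢ = diagUnit` (★ `UnitaryGroupBorelSemidirect`).

* §1 **`exists_torus_diagUnit_eq`** (a torus element with prescribed `(d₀, d₁) = (a, b)`, `c(b) b = 1`),
  `adelicVal_torus_eq_glDiagonal_diagUnit`, **`eq_of_diagUnit_eq`** (`t` is determined by `(d₀ t, d₁ t)`), `continuous_diagUnit_torus`,
  `diagUnit_torus_mul`;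
* §2 **`isCompact_setOf_diagUnit_mem`** — `{t ∈ T(𝔸_F) | d₀ t ∈ C, d₁ t ∈ C₁}` is compact for compact `C, C₁ ⊆ 𝕀_E` (continuous image
  of the compact `{(a, b) ∈ C × C₁ | c(b) b = 1}`, closed by continuity of the coordinates);
* §3 **`exists_torusRay`** — the diagonal ray `ρ(s) = d(z_E(e^s), 1, z_E(e^s)⁻¹)` (`z_E` = ★ `posRealIdele E`, `c`-fixed: ★
  `conjAdele_posRealIdele`): continuous, additive, `d₀(ρ s) = z_E(e^s)`, `d₁(ρ s) = 1`, HEIGHT LAW `H(ρ(s) t) = e^{[E:ℚ] s} H(t)`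
  (★ `borelHeight_torus_mul'` + ★ `ideleNorm_posRealIdele_holds`);
* §4 **`setLIntegral_rpow_neg_borelHeight_lt_top_of_diagUnit`** — THE COORDINATE EDITION OF H10b: for a left-invariant measure finite
  on compacts on `T(𝔸_F)`, compact `C, C₁ ⊆ 𝕀_E`, and `S` with `∀ t ∈ S, (∃ w ∈ C, ∃ s, d₀ t = w · z_E(e^s)) ∧ d₁ t ∈ C₁`:
  `∫⁻_{S ∩ {T₀ < H}} H^{-α} dμT < ∞` for all `T₀ > 0`, `α > 0` (`t = ρ(s) · (ρ(-s) t)` and `ρ(-s) t ∈ {d₀ ∈ C, d₁ ∈ C₁}`).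

## References
* J. D. Rogawski, *Automorphic Representations of Unitary Groups in Three Variables*, Ann. of Math. Stud. 123 (1990), §1.10, §2.2
  [Rogawski1990].
* J. Arthur, *A trace formula for reductive groups I*, Duke Math. J. 45 (1978), §8 [Arthur1978TraceFormulaI].
* A. Borel, *Some finiteness properties of adele groups over number fields*, Publ. Math. IHÉS 16 (1963), §5 [Borel1963].
-/

set_option autoImplicit false

noncomputable section

open MeasureTheory Measure Set NumberField IsDedekindDomain
open scoped NNReal ENNReal Pointwise RestrictedProduct

namespace Literature.NumberTheory.Automorphic

namespace UnitaryGroup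

variable {F E : Type} [Field F] [NumberField F] [Field E] [NumberField E] [Algebra F E] {c : E ≃ₐ[F] E}

omit [NumberField F] in
/-- `𝔸_E` is Hausdorff (standard: a product of Hausdorff completions and a restricted product). [folklore] -/
private theorem t2Space_adeleRing_ray : T2Space (AdeleRing (𝓞 E) E) := by
  haveI : T2Space (FiniteAdeleRing (𝓞 E) E) := inferInstanceAs <| T2Space
    (Πʳ w : HeightOneSpectrum (𝓞 E), [w.adicCompletion E, w.adicCompletionIntegers E])
  haveI : T2Space (InfiniteAdeleRing E) :=
    inferInstanceAs <| T2Space ((w : InfinitePlace E) → w.Completion)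
  exact inferInstanceAs <| T2Space (InfiniteAdeleRing E × FiniteAdeleRing (𝓞 E) E)
/-! ## §1 Torus elements from coordinates -/

section Coordinates

omit [NumberField F] in
/-- The torus relations `c(d_{rev i}) d_i = 1` hold for the diagonal vector `(a, b, (c a)⁻¹)` when `c(b) b = 1` and
`c² = 1`. [cite: Rogawski1990, §1.10] -/
theorem conjAdele_vec3_rev_mul (hc : c * c = 1) (a b : (AdeleRing (𝓞 E) E)ˣ)
    (hb : conjAdele F E c (b : AdeleRing (𝓞 E) E) * b = 1) (i : Fin 3) :
    conjAdele F E c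
        ((![a, b, (Units.map (conjAdele F E c : AdeleRing (𝓞 E) E →* AdeleRing (𝓞 E) E) a)⁻¹] (Fin.rev i) :
          (AdeleRing (𝓞 E) E)ˣ) : AdeleRing (𝓞 E) E) *
        ((![a, b, (Units.map (conjAdele F E c : AdeleRing (𝓞 E) E →* AdeleRing (𝓞 E) E) a)⁻¹] i :
          (AdeleRing (𝓞 E) E)ˣ) : AdeleRing (𝓞 E) E) = 1 := by
  fin_cases i
  · show conjAdele F E c (((Units.map (conjAdele F E c : AdeleRing (𝓞 E) E →* AdeleRing (𝓞 E) E) a)⁻¹ :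
        (AdeleRing (𝓞 E) E)ˣ) : AdeleRing (𝓞 E) E) * (a : AdeleRing (𝓞 E) E) = 1
    rw [Units.coe_map_inv, MonoidHom.coe_coe, conjAdele_conjAdele hc, Units.inv_mul]
  · show conjAdele F E c (b : AdeleRing (𝓞 E) E) * (b : AdeleRing (𝓞 E) E) = 1
    exact hb
  · show conjAdele F E c (a : AdeleRing (𝓞 E) E) *
        (((Units.map (conjAdele F E c : AdeleRing (𝓞 E) E →* AdeleRing (𝓞 E) E) a)⁻¹ : (AdeleRing (𝓞 E) E)ˣ) :
          AdeleRing (𝓞 E) E) = 1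
    rw [Units.coe_map_inv, MonoidHom.coe_coe, ← map_mul, Units.mul_inv, map_one]

omit [NumberField F] in
/-- `diag(a, b, (c a)⁻¹) ∈ U(J₃)(𝔸_F)`. [cite: Rogawski1990, §1.10] -/
theorem glDiagonal_vec3_mem_adelic (hc : c * c = 1) (a b : (AdeleRing (𝓞 E) E)ˣ)
    (hb : conjAdele F E c (b : AdeleRing (𝓞 E) E) * b = 1) :
    glDiagonal 3 (AdeleRing (𝓞 E) E)
        ![a, b, (Units.map (conjAdele F E c : AdeleRing (𝓞 E) E →* AdeleRing (𝓞 E) E) a)⁻¹] ∈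
      adelic F E c 3 ((StdForm.antidiagonal 3).over E) := by
  change glDiagonal 3 (AdeleRing (𝓞 E) E) _ ∈
    unitaryGroupOfForm (conjAdele F E c) (adelicForm E 3 ((StdForm.antidiagonal 3).over E))
  rw [adelicForm_antidiagonal]
  exact (glDiagonal_mem_unitaryGroupOfForm_antidiagonal_iff _ 3 _).2 (conjAdele_vec3_rev_mul hc a b hb)

/-- **Torus elements from coordinates.**  For `a ∈ 𝕀_E` and `b ∈ 𝕀_E` with `c(b) b = 1` there is `t ∈ T(𝔸_F) ≤ B(𝔸_F)` of
`U(J₃)` whose matrix is `diag(a, b, (c a)⁻¹)`; in particular `d₀(t) = a`, `d₁(t) = b`. [cite: Rogawski1990, §1.10] -/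
theorem exists_torus_diagUnit_eq (hc : c * c = 1) (a b : (AdeleRing (𝓞 E) E)ˣ)
    (hb : conjAdele F E c (b : AdeleRing (𝓞 E) E) * b = 1) :
    ∃ t : torusInBorel F E c 3,
      adelicVal F E c 3 _ ((t : borelAdelic F E c 3) : (quasiSplit F E c 3).Adelic) =
          glDiagonal 3 (AdeleRing (𝓞 E) E)
            ![a, b, (Units.map (conjAdele F E c : AdeleRing (𝓞 E) E →* AdeleRing (𝓞 E) E) a)⁻¹] ∧
        diagUnit (t : borelAdelic F E c 3).2 0 = a ∧ diagUnit (t : borelAdelic F E c 3).2 1 = b := by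
  set d : Fin 3 → (AdeleRing (𝓞 E) E)ˣ :=
    ![a, b, (Units.map (conjAdele F E c : AdeleRing (𝓞 E) E →* AdeleRing (𝓞 E) E) a)⁻¹] with hd
  let gA : (quasiSplit F E c 3).Adelic := ⟨glDiagonal 3 (AdeleRing (𝓞 E) E) d, glDiagonal_vec3_mem_adelic hc a b hb⟩
  have hgT : gA ∈ torusAdelic F E c 3 := ⟨d, rfl⟩
  have hgB : gA ∈ borelAdelic F E c 3 := torusAdelic_le_borelAdelic hgT
  refine ⟨⟨⟨gA, hgB⟩, hgT⟩, rfl, ?_, ?_⟩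
  · ext
    rw [coe_diagUnit]
    show (glDiagonal 3 (AdeleRing (𝓞 E) E) d : Matrix (Fin 3) (Fin 3) (AdeleRing (𝓞 E) E)) 0 0 = a
    rw [coe_glDiagonal, Matrix.diagonal_apply_eq]
    rfl
  · ext
    rw [coe_diagUnit]
    show (glDiagonal 3 (AdeleRing (𝓞 E) E) d : Matrix (Fin 3) (Fin 3) (AdeleRing (𝓞 E) E)) 1 1 = b
    rw [coe_glDiagonal, Matrix.diagonal_apply_eq]
    rfl

/-- The diagonal entries of a torus element as a matrix identity: `adelicVal t = diag(d₀ t, d₁ t, d₂ t)`.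
[cite: Rogawski1990, §1.10] -/
theorem adelicVal_torus_eq_glDiagonal_diagUnit (t : torusInBorel F E c 3) :
    adelicVal F E c 3 _ ((t : borelAdelic F E c 3) : (quasiSplit F E c 3).Adelic) =
      glDiagonal 3 (AdeleRing (𝓞 E) E) (diagUnit (t : borelAdelic F E c 3).2) := by
  obtain ⟨d, hd⟩ := (mem_torusInBorel_iff (t : borelAdelic F E c 3)).1 t.2
  rw [← hd]
  congr 1
  funext i
  ext
  rw [coe_diagUnit, ← hd, coe_glDiagonal, Matrix.diagonal_apply_eq]

/-- **A torus element is determined by `(d₀, d₁)`** (`d₂ = (c d₀)⁻¹` by the torus relation `c(d₀) d₂ = 1`).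
[cite: Rogawski1990, §1.10] -/
theorem eq_of_diagUnit_eq {t t' : torusInBorel F E c 3}
    (h0 : diagUnit (t : borelAdelic F E c 3).2 0 = diagUnit (t' : borelAdelic F E c 3).2 0)
    (h1 : diagUnit (t : borelAdelic F E c 3).2 1 = diagUnit (t' : borelAdelic F E c 3).2 1) : t = t' := by
  have ht := adelicVal_torus_eq_glDiagonal_diagUnit t
  have ht' := adelicVal_torus_eq_glDiagonal_diagUnit t'
  -- `d₂` is determined by `d₀`
  have key : ∀ (u : torusInBorel F E c 3),
      conjAdele F E c ((diagUnit (u : borelAdelic F E c 3).2 0 : (AdeleRing (𝓞 E) E)ˣ) : AdeleRing (𝓞 E) E) *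
        (diagUnit (u : borelAdelic F E c 3).2 2 : (AdeleRing (𝓞 E) E)ˣ) = 1 := fun u =>
    (torus_relations u (adelicVal_torus_eq_glDiagonal_diagUnit u).symm).2.2
  have h2 : diagUnit (t : borelAdelic F E c 3).2 2 = diagUnit (t' : borelAdelic F E c 3).2 2 := by
    have e1 := key t
    have e2 := key t'
    rw [← h0] at e2
    -- both are right inverses of `c(d₀ t)` in the commutative monoid `𝔸_E`
    ext
    calc ((diagUnit (t : borelAdelic F E c 3).2 2 : (AdeleRing (𝓞 E) E)ˣ) : AdeleRing (𝓞 E) E)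
        = (diagUnit (t : borelAdelic F E c 3).2 2 : AdeleRing (𝓞 E) E) *
            (conjAdele F E c ((diagUnit (t : borelAdelic F E c 3).2 0 : (AdeleRing (𝓞 E) E)ˣ) : AdeleRing (𝓞 E) E) *
              (diagUnit (t' : borelAdelic F E c 3).2 2 : AdeleRing (𝓞 E) E)) := by rw [e2, mul_one]
      _ = (conjAdele F E c ((diagUnit (t : borelAdelic F E c 3).2 0 : (AdeleRing (𝓞 E) E)ˣ) : AdeleRing (𝓞 E) E) *
            (diagUnit (t : borelAdelic F E c 3).2 2 : AdeleRing (𝓞 E) E)) *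
              (diagUnit (t' : borelAdelic F E c 3).2 2 : AdeleRing (𝓞 E) E) := by ring
      _ = (diagUnit (t' : borelAdelic F E c 3).2 2 : AdeleRing (𝓞 E) E) := by rw [e1, one_mul]
  have hfun : diagUnit (t : borelAdelic F E c 3).2 = diagUnit (t' : borelAdelic F E c 3).2 := by
    funext i
    fin_cases i
    · exact h0
    · exact h1
    · exact h2
  have hval : adelicVal F E c 3 _ ((t : borelAdelic F E c 3) : (quasiSplit F E c 3).Adelic) =
      adelicVal F E c 3 _ ((t' : borelAdelic F E c 3) : (quasiSplit F E c 3).Adelic) := by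
    rw [ht, ht', hfun]
  exact Subtype.ext (Subtype.ext (adelicVal_injective F E c 3 _ hval))

/-- The coordinate `t ↦ d_i(t) ∈ 𝕀_E` is continuous on `T(𝔸_F)` (entries of `t` and `t⁻¹` are continuous; same argument as
★ `continuous_torusPart`). [cite: Rogawski1990, §1.10] -/
theorem continuous_diagUnit_torus (i : Fin 3) :
    Continuous fun t : torusInBorel F E c 3 => diagUnit (t : borelAdelic F E c 3).2 i := by
  have hmat : Continuous fun g : (quasiSplit F E c 3).Adelic =>
      (adelicVal F E c 3 _ g : Matrix (Fin 3) (Fin 3) (AdeleRing (𝓞 E) E)) :=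
    Units.continuous_val.comp continuous_subtype_val
  refine Units.continuous_iff.2 ⟨?_, ?_⟩
  · exact ((hmat.comp continuous_subtype_val).matrix_elem i i).comp continuous_subtype_val
  · change Continuous fun t : torusInBorel F E c 3 =>
      (adelicVal F E c 3 _ (((t : borelAdelic F E c 3) : (quasiSplit F E c 3).Adelic)⁻¹) :
        Matrix (Fin 3) (Fin 3) (AdeleRing (𝓞 E) E)) i i
    exact ((hmat.comp continuous_subtype_val.inv).matrix_elem i i).comp continuous_subtype_val

/-! ## §2 Coordinate compacta of the torus -/

/-- **`{t ∈ T(𝔸_F) | d₀ t ∈ C, d₁ t ∈ C₁}` is compact** for compact `C, C₁ ⊆ 𝕀_E`: it is the continuous image of the compact set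
`{(a, b) ∈ C × C₁ | c(b) b = 1}` under `(a, b) ↦ d(a, b, (c a)⁻¹)` (§1). [cite: Rogawski1990, §1.10] [cite: Borel1963, §5] -/
theorem isCompact_setOf_diagUnit_mem (hc : c * c = 1) {C C₁ : Set (AdeleRing (𝓞 E) E)ˣ} (hC : IsCompact C)
    (hC₁ : IsCompact C₁) :
    IsCompact {t : torusInBorel F E c 3 |
      diagUnit (t : borelAdelic F E c 3).2 0 ∈ C ∧ diagUnit (t : borelAdelic F E c 3).2 1 ∈ C₁} := by
  haveI : T2Space (AdeleRing (𝓞 E) E) := t2Space_adeleRing_ray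
  -- the closed relation `c(b) b = 1` on the second coordinate
  let P : Set ((AdeleRing (𝓞 E) E)ˣ × (AdeleRing (𝓞 E) E)ˣ) :=
    {p | conjAdele F E c ((p.2 : (AdeleRing (𝓞 E) E)ˣ) : AdeleRing (𝓞 E) E) * p.2 = 1}
  have hPc : IsClosed P :=
    isClosed_eq (((continuous_conjAdele F E c).comp (Units.continuous_val.comp continuous_snd)).mul
      (Units.continuous_val.comp continuous_snd)) continuous_const
  have hK₀ : IsCompact ((C ×ˢ C₁) ∩ P) := (hC.prod hC₁).inter_right hPc
  -- the chart on `P`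
  let dv : (AdeleRing (𝓞 E) E)ˣ × (AdeleRing (𝓞 E) E)ˣ → Fin 3 → (AdeleRing (𝓞 E) E)ˣ := fun p =>
    ![p.1, p.2, (Units.map (conjAdele F E c : AdeleRing (𝓞 E) E →* AdeleRing (𝓞 E) E) p.1)⁻¹]
  have hdv : Continuous dv := by
    refine continuous_pi fun i => ?_
    fin_cases i
    · exact continuous_fst
    · exact continuous_snd
    · exact ((continuous_conjAdele F E c).units_map.comp continuous_fst).inv
  have hmemA : ∀ p : P, glDiagonal 3 (AdeleRing (𝓞 E) E) (dv p) ∈ adelic F E c 3 ((StdForm.antidiagonal 3).over E) :=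
    fun p => glDiagonal_vec3_mem_adelic hc p.1.1 p.1.2 p.2
  let τA : P → (quasiSplit F E c 3).Adelic := fun p => ⟨glDiagonal 3 (AdeleRing (𝓞 E) E) (dv p), hmemA p⟩
  have hτA : Continuous τA :=
    (((continuous_glDiagonal (n := 3) (AdeleRing (𝓞 E) E)).comp (hdv.comp continuous_subtype_val))).subtype_mk _
  have hmemT : ∀ p : P, τA p ∈ torusAdelic F E c 3 := fun p => ⟨dv p, rfl⟩
  have hmemB : ∀ p : P, τA p ∈ borelAdelic F E c 3 := fun p => torusAdelic_le_borelAdelic (hmemT p)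
  let τ : P → torusInBorel F E c 3 := fun p => ⟨⟨τA p, hmemB p⟩, hmemT p⟩
  have hτ : Continuous τ := (hτA.subtype_mk _).subtype_mk _
  have hd0 : ∀ p : P, diagUnit ((τ p : torusInBorel F E c 3) : borelAdelic F E c 3).2 0 = p.1.1 := fun p => by
    ext
    rw [coe_diagUnit]
    show (glDiagonal 3 (AdeleRing (𝓞 E) E) (dv p) : Matrix (Fin 3) (Fin 3) (AdeleRing (𝓞 E) E)) 0 0 = _
    rw [coe_glDiagonal, Matrix.diagonal_apply_eq]
    rfl
  have hd1 : ∀ p : P, diagUnit ((τ p : torusInBorel F E c 3) : borelAdelic F E c 3).2 1 = p.1.2 := fun p => by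
    ext
    rw [coe_diagUnit]
    show (glDiagonal 3 (AdeleRing (𝓞 E) E) (dv p) : Matrix (Fin 3) (Fin 3) (AdeleRing (𝓞 E) E)) 1 1 = _
    rw [coe_glDiagonal, Matrix.diagonal_apply_eq]
    rfl
  -- the set is the image of `val⁻¹' (C ×ˢ C₁)` under `τ`
  have hK : IsCompact ((Subtype.val : P → _) ⁻¹' (C ×ˢ C₁)) :=
    hPc.isClosedEmbedding_subtypeVal.isCompact_preimage (hC.prod hC₁)
  refine (hK.image hτ).of_isClosed_subset ?_ ?_
  · exact (IsClosed.inter (hC.isClosed.preimage (continuous_diagUnit_torus 0))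
      (hC₁.isClosed.preimage (continuous_diagUnit_torus 1)))
  · rintro t ⟨ht0, ht1⟩
    -- `t = τ (d₀ t, d₁ t)`
    have hrel : conjAdele F E c ((diagUnit (t : borelAdelic F E c 3).2 1 : (AdeleRing (𝓞 E) E)ˣ) : AdeleRing (𝓞 E) E) *
        (diagUnit (t : borelAdelic F E c 3).2 1 : (AdeleRing (𝓞 E) E)ˣ) = 1 :=
      (torus_relations t (adelicVal_torus_eq_glDiagonal_diagUnit t).symm).2.1
    let p : P := ⟨(diagUnit (t : borelAdelic F E c 3).2 0, diagUnit (t : borelAdelic F E c 3).2 1), hrel⟩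
    refine ⟨p, ⟨ht0, ht1⟩, ?_⟩
    exact eq_of_diagUnit_eq (hd0 p) (hd1 p)
/-! ## §3 The diagonal ray `ρ(s) = d(z_E(e^s), 1, z_E(e^s)⁻¹)` and its height law -/

omit [NumberField F] in
/-- `e^{a+b} = e^a e^b` in `ℝ≥0ˣ` (for the tree's `expUnitNNReal`). [folklore] -/
private theorem expUnitNNReal_add' (a b : ℝ) : expUnitNNReal (a + b) = expUnitNNReal a * expUnitNNReal b := by
  ext
  change Real.exp (a + b) = Real.exp a * Real.exp b
  exact Real.exp_add a b

/-- **THE DIAGONAL RAY OF `T(𝔸_F) ≤ U(J₃)`.**  There is a continuous one-parameter family `ρ : ℝ → T(𝔸_F)`,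
`ρ(a + b) = ρ(a) ρ(b)`, with coordinates `d₀(ρ s) = z_E(e^s)` (the positive real scalar idele, `c`-fixed) and `d₁(ρ s) = 1`,
along which the Borel height is HOMOGENEOUS: `H(ρ(s) t) = e^{[E:ℚ] s} · H(t)` (`H(d(a,·,·) g) = ‖a‖_{𝔸_E} H(g)`,
`‖z_E(r)‖ = r^{[E:ℚ]}`). [cite: Rogawski1990, §2.2] [cite: Borel1963, §5] [cite: Arthur1978TraceFormulaI, §8 (pp. 947–950)] -/
theorem exists_torusRay (hc : c * c = 1) :
    ∃ ρ : ℝ → torusInBorel F E c 3, Continuous ρ ∧ (∀ a b, ρ (a + b) = ρ a * ρ b) ∧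
      (∀ s, diagUnit ((ρ s : torusInBorel F E c 3) : borelAdelic F E c 3).2 0 = posRealIdele E (expUnitNNReal s) ∧
        diagUnit ((ρ s : torusInBorel F E c 3) : borelAdelic F E c 3).2 1 = 1) ∧
      ∀ (s : ℝ) (t : torusInBorel F E c 3),
        (borelHeight (((ρ s * t : torusInBorel F E c 3) : borelAdelic F E c 3) : (quasiSplit F E c 3).Adelic) : ℝ) =
          Real.exp (Module.finrank ℚ E * s) *
            borelHeight (((t : torusInBorel F E c 3) : borelAdelic F E c 3) : (quasiSplit F E c 3).Adelic) := by
  have h1 : conjAdele F E c (((1 : (AdeleRing (𝓞 E) E)ˣ)) : AdeleRing (𝓞 E) E) * (1 : (AdeleRing (𝓞 E) E)ˣ) = 1 := by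
    rw [Units.val_one, map_one, one_mul]
  let dv : ℝ → Fin 3 → (AdeleRing (𝓞 E) E)ˣ := fun s =>
    ![posRealIdele E (expUnitNNReal s), 1,
      (Units.map (conjAdele F E c : AdeleRing (𝓞 E) E →* AdeleRing (𝓞 E) E) (posRealIdele E (expUnitNNReal s)))⁻¹]
  have hdv : Continuous dv := by
    have hz : Continuous fun s : ℝ => posRealIdele E (expUnitNNReal s) :=
      (continuous_posRealIdele E).comp continuous_expUnitNNReal
    refine continuous_pi fun i => ?_
    fin_cases i
    · exact hz
    · exact continuous_const
    · exact ((continuous_conjAdele F E c).units_map.comp hz).inv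
  have hmemA : ∀ s, glDiagonal 3 (AdeleRing (𝓞 E) E) (dv s) ∈ adelic F E c 3 ((StdForm.antidiagonal 3).over E) :=
    fun s => glDiagonal_vec3_mem_adelic hc _ 1 h1
  let ρA : ℝ → (quasiSplit F E c 3).Adelic := fun s => ⟨glDiagonal 3 (AdeleRing (𝓞 E) E) (dv s), hmemA s⟩
  have hρA : Continuous ρA := ((continuous_glDiagonal (n := 3) (AdeleRing (𝓞 E) E)).comp hdv).subtype_mk _
  have hmemT : ∀ s, ρA s ∈ torusAdelic F E c 3 := fun s => ⟨dv s, rfl⟩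
  have hmemB : ∀ s, ρA s ∈ borelAdelic F E c 3 := fun s => torusAdelic_le_borelAdelic (hmemT s)
  let ρ : ℝ → torusInBorel F E c 3 := fun s => ⟨⟨ρA s, hmemB s⟩, hmemT s⟩
  have hρ : Continuous ρ := (hρA.subtype_mk _).subtype_mk _
  -- the diagonal vector is multiplicative in `s` (the third entry: `z_E` is `c`-fixed)
  have hdv_add : ∀ a b, dv (a + b) = dv a * dv b := by
    intro a b
    funext i
    fin_cases i
    · show posRealIdele E (expUnitNNReal (a + b)) = posRealIdele E (expUnitNNReal a) * posRealIdele E (expUnitNNReal b)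
      rw [expUnitNNReal_add', map_mul]
    · show (1 : (AdeleRing (𝓞 E) E)ˣ) = 1 * 1
      rw [mul_one]
    · show (Units.map (conjAdele F E c : AdeleRing (𝓞 E) E →* AdeleRing (𝓞 E) E) (posRealIdele E (expUnitNNReal (a + b))))⁻¹ =
        (Units.map (conjAdele F E c : AdeleRing (𝓞 E) E →* AdeleRing (𝓞 E) E) (posRealIdele E (expUnitNNReal a)))⁻¹ *
          (Units.map (conjAdele F E c : AdeleRing (𝓞 E) E →* AdeleRing (𝓞 E) E) (posRealIdele E (expUnitNNReal b)))⁻¹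
      rw [expUnitNNReal_add', map_mul, map_mul, mul_inv, mul_comm]
  refine ⟨ρ, hρ, fun a b => ?_, fun s => ⟨?_, ?_⟩, fun s t => ?_⟩
  · -- additivity
    apply Subtype.ext; apply Subtype.ext
    show ρA (a + b) = ρA a * ρA b
    apply Subtype.ext
    show glDiagonal 3 (AdeleRing (𝓞 E) E) (dv (a + b)) = glDiagonal 3 (AdeleRing (𝓞 E) E) (dv a) * glDiagonal 3 _ (dv b)
    rw [hdv_add, map_mul]
  · ext
    rw [coe_diagUnit]
    show (glDiagonal 3 (AdeleRing (𝓞 E) E) (dv s) : Matrix (Fin 3) (Fin 3) (AdeleRing (𝓞 E) E)) 0 0 = _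
    rw [coe_glDiagonal, Matrix.diagonal_apply_eq]
    rfl
  · ext
    rw [coe_diagUnit]
    show (glDiagonal 3 (AdeleRing (𝓞 E) E) (dv s) : Matrix (Fin 3) (Fin 3) (AdeleRing (𝓞 E) E)) 1 1 = _
    rw [coe_glDiagonal, Matrix.diagonal_apply_eq]
    rfl
  · -- height law
    have hd : glDiagonal 3 (AdeleRing (𝓞 E) E) (dv s) =
        adelicVal F E c 3 _ (((ρ s : torusInBorel F E c 3) : borelAdelic F E c 3) : (quasiSplit F E c 3).Adelic) := rfl
    have hmul : (((ρ s * t : torusInBorel F E c 3) : borelAdelic F E c 3) : (quasiSplit F E c 3).Adelic) =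
        (((ρ s : torusInBorel F E c 3) : borelAdelic F E c 3) : (quasiSplit F E c 3).Adelic) *
          (((t : torusInBorel F E c 3) : borelAdelic F E c 3) : (quasiSplit F E c 3).Adelic) := rfl
    rw [hmul, borelHeight_torus_mul' hd, NNReal.coe_mul]
    congr 1
    show ((IdeleClassGroup.ideleNorm E (posRealIdele E (expUnitNNReal s)) : ℝ≥0) : ℝ) = _
    rw [ideleNorm_posRealIdele_holds E (expUnitNNReal s), NNReal.coe_pow, coe_expUnitNNReal, ← Real.exp_nat_mul]

/-- **`d_i` is multiplicative on the torus**: `d_i(t t′) = d_i(t) d_i(t′)` (diagonal matrices). [cite: Rogawski1990, §1.10] -/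
theorem diagUnit_torus_mul (t t' : torusInBorel F E c 3) (i : Fin 3) :
    diagUnit ((t * t' : torusInBorel F E c 3) : borelAdelic F E c 3).2 i =
      diagUnit (t : borelAdelic F E c 3).2 i * diagUnit (t' : borelAdelic F E c 3).2 i := by
  ext
  rw [Units.val_mul, coe_diagUnit, coe_diagUnit, coe_diagUnit]
  have hmul : adelicVal F E c 3 _ (((t * t' : torusInBorel F E c 3) : borelAdelic F E c 3) : (quasiSplit F E c 3).Adelic) =
      adelicVal F E c 3 _ (((t : torusInBorel F E c 3) : borelAdelic F E c 3) : (quasiSplit F E c 3).Adelic) *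
        adelicVal F E c 3 _ (((t' : torusInBorel F E c 3) : borelAdelic F E c 3) : (quasiSplit F E c 3).Adelic) :=
    map_mul _ _ _
  rw [hmul, Units.val_mul, adelicVal_torus_eq_glDiagonal_diagUnit t, coe_glDiagonal, Matrix.diagonal_mul,
    Matrix.diagonal_apply_eq]
/-! ## §4 The ray integral in torus coordinates (the coordinate edition of H10b) -/

/-- **H10b IN COORDINATES.**  Let `μT` be a left-invariant measure, finite on compacts, on the adelic torus `T(𝔸_F)` of
`U(J₃)`, `C, C₁ ⊆ 𝕀_E` compact, and `S ⊆ T(𝔸_F)` a set whose elements have coordinates `d₀(t) = w · z_E(e^s)` with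
`w ∈ C` (some `s ∈ ℝ`) and `d₁(t) ∈ C₁` — the EXPORT clause of the torus Siegel set of row H9a (`UnitaryGroupTorusSiegelSet`),
stable under saturation by `T(𝔸_F) ∩ K` for a compact `K` (enlarge `C, C₁`).  Then for all `T₀ > 0`, `α > 0`:
`∫⁻_{S ∩ {T₀ < H}} H(t)^{-α} dμT < ∞`.  (§3 ray + §2 compactum feed ★ `setLIntegral_rpow_neg_borelHeight_lt_top`:
`t = ρ(s) · (ρ(-s) t)` with `ρ(-s) t ∈ {d₀ ∈ C, d₁ ∈ C₁}`.) [cite: Arthur1978TraceFormulaI, §8 (pp. 947–950)]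
[cite: Rogawski1990, §2.2] -/
theorem setLIntegral_rpow_neg_borelHeight_lt_top_of_diagUnit (hc : c * c = 1)
    [MeasurableSpace (quasiSplit F E c 3).Adelic] [BorelSpace (quasiSplit F E c 3).Adelic]
    (μT : Measure (torusInBorel F E c 3)) [μT.IsMulLeftInvariant] [IsFiniteMeasureOnCompacts μT]
    {C C₁ : Set (AdeleRing (𝓞 E) E)ˣ} (hC : IsCompact C) (hC₁ : IsCompact C₁) {S : Set (torusInBorel F E c 3)}
    (hS : ∀ t ∈ S, (∃ w ∈ C, ∃ s : ℝ, diagUnit (t : borelAdelic F E c 3).2 0 = w * posRealIdele E (expUnitNNReal s)) ∧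
      diagUnit (t : borelAdelic F E c 3).2 1 ∈ C₁)
    {T₀ : ℝ≥0} (hT₀ : 0 < T₀) {α : ℝ} (hα : 0 < α) :
    ∫⁻ t in S ∩ {t | T₀ < borelHeight (((t : torusInBorel F E c 3) : borelAdelic F E c 3) :
        (quasiSplit F E c 3).Adelic)},
      ENNReal.ofReal ((borelHeight (((t : torusInBorel F E c 3) : borelAdelic F E c 3) :
        (quasiSplit F E c 3).Adelic) : ℝ) ^ (-α)) ∂μT < ∞ := by
  obtain ⟨ρ, hρc, hρadd, hρd, hH⟩ := exists_torusRay (F := F) (E := E) (c := c) hc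
  have h𝔎 := isCompact_setOf_diagUnit_mem (F := F) hc hC hC₁
  have hκ : 0 < (Module.finrank ℚ E : ℝ) := Nat.cast_pos.2 Module.finrank_pos
  -- `ρ 0 = 1` and `z_E(e^{-s}) z_E(e^s) = 1`
  have hρ0 : ρ 0 = 1 := by
    have h := hρadd 0 0
    rw [add_zero] at h
    exact mul_eq_left.1 h.symm
  have hz : ∀ s : ℝ, posRealIdele E (expUnitNNReal (-s)) * posRealIdele E (expUnitNNReal s) = 1 := fun s => by
    rw [← map_mul, ← expUnitNNReal_add', neg_add_cancel]
    have h0 : expUnitNNReal 0 = 1 := by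
      ext
      change Real.exp 0 = 1
      exact Real.exp_zero
    rw [h0, map_one]
  have hsub : S ⊆ Set.range ρ * {t : torusInBorel F E c 3 |
      diagUnit (t : borelAdelic F E c 3).2 0 ∈ C ∧ diagUnit (t : borelAdelic F E c 3).2 1 ∈ C₁} := by
    intro t ht
    obtain ⟨⟨w, hw, s, hs⟩, h1⟩ := hS t ht
    refine Set.mem_mul.2 ⟨ρ s, ⟨s, rfl⟩, ρ (-s) * t, ⟨?_, ?_⟩, ?_⟩
    · show diagUnit ((ρ (-s) * t : torusInBorel F E c 3) : borelAdelic F E c 3).2 0 ∈ C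
      rw [diagUnit_torus_mul, (hρd (-s)).1, hs, mul_left_comm, hz, mul_one]
      exact hw
    · show diagUnit ((ρ (-s) * t : torusInBorel F E c 3) : borelAdelic F E c 3).2 1 ∈ C₁
      rw [diagUnit_torus_mul, (hρd (-s)).2, one_mul]
      exact h1
    · rw [← mul_assoc, ← hρadd, add_neg_cancel, hρ0, one_mul]
  exact setLIntegral_rpow_neg_borelHeight_lt_top μT h𝔎 hρc hρadd hκ hH hsub hT₀ hα

end Coordinates

end UnitaryGroup

end Literature.NumberTheory.Automorphic

end
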